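import Summits.HubbardSuperconductivity.HubbardSuperconductivity.Theorems.LevyLogBootstrapDressHalfFilledInterHopCross
import Literature.MathematicalPhysics.QuantumLattice.InterClusterKernelHopVectors
import HarnessLib

/-!
# Route `LevyLogBootstrap` / `AnisotropyChord`, crux `DressHalfFilled` (stmt-HubbardSuperconductivity-8148), stub 2
# `stub_plaquetteDictionary`, clause (d) — step 3: the DIAGONAL (same-bond) second-order term is Kato's two-plaquette kernel

Support file (`--supports stmt-HubbardSuperconductivity-8148`), continuing `…InterHopColumns` (step 1), `…InterHopCross`
(step 2) (the environment overlap / energy bookkeeping of `…InterHopDiag` is re-derived inline). For one oriented bond `(R, R + e_k)` of the plaquette torus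
(`M ≥ 2`), two dictionary columns `σ', σ` whose bond occupations `κ' = ((σ' R).rev, (σ' (R+e_k)).rev)`, `κ` have the same
pair energy, and the environment energy `E₀ = Σ_c E_c(σ)` of the ket column:

  `⟨slice_{R,R+e_k}(ψ_σ') hop_{R,k}(σ'), S_{H_in}(E₀) slice_{R,R+e_k}(ψ_σ) hop_{R,k}(σ)⟩
     = [σ' = σ off {R, R+e_k}] · (−interClusterKernel H_plaq (plaquetteStates U) (bondHopping (bonds k)) κ' κ)`

(`diag_bond_term_eq`): the reduced resolvent acts inside the slice at the local energy `E_R + E_{R+e_k} = pairEnergy κ`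
(`ClusterProductSlice.star_sliceMap_mulVec_dotProduct_reducedResolvent_sliceMap_mulVec`, `local_energy_eq_pair`), the
environment overlap is `[σ' = σ off bond]` (`prod_env_overlap`), and the two-cluster bracket of the hop vectors is
`−interClusterKernel` (`InterClusterKernelHopVectors`, orientation phases `ε₁ ε₂` with `ε̄₁ ε₂ = −1`).

References: W.-F. Tsai, S. A. Kivelson, PRB 73 (2006) 214510, App. A (A1) [TsaiKivelson2006]; T. Kato (1966) II-§2.2.
No definition and no named fact is introduced; all statements are [folklore].
-/

set_option linter.dupNamespace false

noncomputable section

namespace Summit.HubbardSuperconductivity.HubbardSuperconductivity.Theorems.LevyLogBootstrap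

open Matrix Literature.MathematicalPhysics.QuantumLattice Literature.Probability.LatticeModels
open Literature.MathematicalPhysics.QuantumLattice.TorusPlaquette TwoCluster

variable {M : ℕ} [NeZero M]

/-- The orientation phases of a bond: `ε₁ = [R+e_k < R ? −1 : 1]`, `ε₂ = [R < R+e_k ? −1 : 1]` are unit signs with
`ε̄₁ ε₂ = ε̄₂ ε₁ = −1` (exactly one of the two comparisons holds). [folklore] -/
theorem bond_phases (hM : 2 ≤ M) (R : FermionTorus 2 M) (k : Fin 2) :
    star (if plaqNbr R k < R then (-1 : ℂ) else 1) * (if plaqNbr R k < R then (-1 : ℂ) else 1) = 1 ∧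
    star (if R < plaqNbr R k then (-1 : ℂ) else 1) * (if R < plaqNbr R k then (-1 : ℂ) else 1) = 1 ∧
    star (if plaqNbr R k < R then (-1 : ℂ) else 1) * (if R < plaqNbr R k then (-1 : ℂ) else 1) = -1 ∧
    star (if R < plaqNbr R k then (-1 : ℂ) else 1) * (if plaqNbr R k < R then (-1 : ℂ) else 1) = -1 := by
  rcases lt_or_gt_of_ne (plaqNbr_ne hM R k) with h | h
  · have h' : ¬R < plaqNbr R k := not_lt.2 h.le
    simp [h, h']
  · have h' : ¬plaqNbr R k < R := not_lt.2 h.le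
    simp [h, h']

/-- **The diagonal second-order term of one bond is Kato's two-plaquette kernel** (see the module doc-string).
[cite: TsaiKivelson2006, App. A (A1)] -/
theorem diag_bond_term_eq (hM : 2 ≤ M) (U : ℝ) (σ' σ : TensorIndex (TorusSite 2 M) 2) (R : FermionTorus 2 M)
    (k : Fin 2) (B : Finset (PlaquetteSite × PlaquetteSite))
    (hE : pairEnergy (plaquetteHamiltonian U) (plaquetteStates U)
        ((σ' (FermionTorus.toTorusSite R)).rev, (σ' (FermionTorus.toTorusSite (plaqNbr R k))).rev) =
      pairEnergy (plaquetteHamiltonian U) (plaquetteStates U)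
        ((σ (FermionTorus.toTorusSite R)).rev, (σ (FermionTorus.toTorusSite (plaqNbr R k))).rev)) :
    star ((plaquettePartition M).sliceMap (plaqFamily U σ') R (plaqNbr R k) *ᵥ
        ∑ q ∈ B, ∑ s : Fin 2,
          ((if plaqNbr R k < R then (-1 : ℂ) else 1) •
              tensorVec (creation (orb q.1 s) *ᵥ plaqFamily U σ' R)
                (annihilation (orb q.2 s) *ᵥ plaqFamily U σ' (plaqNbr R k)) +
            (if R < plaqNbr R k then (-1 : ℂ) else 1) •
              tensorVec (annihilation (orb q.1 s) *ᵥ plaqFamily U σ' R)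
                (creation (orb q.2 s) *ᵥ plaqFamily U σ' (plaqNbr R k)))) ⬝ᵥ
      (reducedResolvent (hamiltonian (fermionTorusGraph 2 (2 * M) \ SimpleGraph.comap
          (fun x : FermionTorus 2 (2 * M) => fun i : Fin 2 => ((ofLex x) i : ℕ) / 2) ⊤) 1 U)
          (∑ c : FermionTorus 2 M, plaquetteEnergy U (2 * ((Fin.rev (σ (FermionTorus.toTorusSite c)) : Fin 2) : ℕ))) *ᵥ
        ((plaquettePartition M).sliceMap (plaqFamily U σ) R (plaqNbr R k) *ᵥ
          ∑ q ∈ B, ∑ s : Fin 2,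
            ((if plaqNbr R k < R then (-1 : ℂ) else 1) •
                tensorVec (creation (orb q.1 s) *ᵥ plaqFamily U σ R)
                  (annihilation (orb q.2 s) *ᵥ plaqFamily U σ (plaqNbr R k)) +
              (if R < plaqNbr R k then (-1 : ℂ) else 1) •
                tensorVec (annihilation (orb q.1 s) *ᵥ plaqFamily U σ R)
                  (creation (orb q.2 s) *ᵥ plaqFamily U σ (plaqNbr R k))))) =
      (if ∀ c : FermionTorus 2 M, c ≠ plaqNbr R k → c ≠ R →
          σ' (FermionTorus.toTorusSite c) = σ (FermionTorus.toTorusSite c) then (1 : ℂ) else 0) *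
        -interClusterKernel (plaquetteHamiltonian_isHermitian U) (plaquetteStates U) (bondHopping B)
          ((σ' (FermionTorus.toTorusSite R)).rev, (σ' (FermionTorus.toTorusSite (plaqNbr R k))).rev)
          ((σ (FermionTorus.toTorusSite R)).rev, (σ (FermionTorus.toTorusSite (plaqNbr R k))).rev) := by
  have hRN : R ≠ plaqNbr R k := (plaqNbr_ne hM R k).symm
  -- the intra-plaquette Hamiltonian is the sum of the embedded plaquette Hamiltonians over the partition
  have hsum : hamiltonian (fermionTorusGraph 2 (2 * M) \ SimpleGraph.comap
      (fun x : FermionTorus 2 (2 * M) => fun i : Fin 2 => ((ofLex x) i : ℕ) / 2) ⊤) 1 U =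
      ∑ c : FermionTorus 2 M, jwEmbed ((plaquettePartition M).emb c)
        ((fun _ : FermionTorus 2 M => plaquetteHamiltonian U) c) := by
    simpa only [plaquettePartition_emb] using hamiltonian_intra_eq_sum_jwEmbed_plaquetteHamiltonian hM U
  have hψ : ∀ c : FermionTorus 2 M, c ≠ R → c ≠ plaqNbr R k →
      (fun _ : FermionTorus 2 M => plaquetteHamiltonian U) c *ᵥ plaqFamily U σ c =
        (((fun c : FermionTorus 2 M =>
            plaquetteEnergy U (2 * ((Fin.rev (σ (FermionTorus.toTorusSite c)) : Fin 2) : ℕ))) c : ℝ) : ℂ) •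
          plaqFamily U σ c :=
    fun c _ _ => plaquetteHamiltonian_mulVec_plaquetteStates U _
  -- the two-cluster reduction of the bracket
  have key := (plaquettePartition M).star_sliceMap_mulVec_dotProduct_reducedResolvent_sliceMap_mulVec hRN
    (A := fun _ : FermionTorus 2 M => plaquetteHamiltonian U) (fun _ => isParityPreserving_plaquetteHamiltonian U)
    (fun _ => plaquetteHamiltonian_isHermitian U) (LiebThm1.hamiltonian_isHermitian _ 1 U) hsum
    (plaqFamily U σ') (plaqFamily U σ) hψ
    (∑ c : FermionTorus 2 M, plaquetteEnergy U (2 * ((Fin.rev (σ (FermionTorus.toTorusSite c)) : Fin 2) : ℕ)))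
    (∑ q ∈ B, ∑ s : Fin 2,
      ((if plaqNbr R k < R then (-1 : ℂ) else 1) •
          tensorVec (creation (orb q.1 s) *ᵥ plaqFamily U σ' R)
            (annihilation (orb q.2 s) *ᵥ plaqFamily U σ' (plaqNbr R k)) +
        (if R < plaqNbr R k then (-1 : ℂ) else 1) •
          tensorVec (annihilation (orb q.1 s) *ᵥ plaqFamily U σ' R)
            (creation (orb q.2 s) *ᵥ plaqFamily U σ' (plaqNbr R k))))
    (∑ q ∈ B, ∑ s : Fin 2,
      ((if plaqNbr R k < R then (-1 : ℂ) else 1) •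
          tensorVec (creation (orb q.1 s) *ᵥ plaqFamily U σ R)
            (annihilation (orb q.2 s) *ᵥ plaqFamily U σ (plaqNbr R k)) +
        (if R < plaqNbr R k then (-1 : ℂ) else 1) •
          tensorVec (annihilation (orb q.1 s) *ᵥ plaqFamily U σ R)
            (creation (orb q.2 s) *ᵥ plaqFamily U σ (plaqNbr R k))))
  -- environment overlap and local energy (cf. `…InterHopDiag.prod_env_overlap` / `local_energy_eq_pair`)
  have hover : ∀ {inst : DecidableEq (FermionTorus 2 M)},
      ∏ c ∈ @Finset.erase _ inst (@Finset.erase _ inst Finset.univ R) (plaqNbr R k),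
          star (plaqFamily U σ' c) ⬝ᵥ plaqFamily U σ c =
        if ∀ c : FermionTorus 2 M, c ≠ plaqNbr R k → c ≠ R →
          σ' (FermionTorus.toTorusSite c) = σ (FermionTorus.toTorusSite c) then (1 : ℂ) else 0 := by
    intro inst
    have h1 : ∀ c, star (plaqFamily U σ' c) ⬝ᵥ plaqFamily U σ c =
        if σ' (FermionTorus.toTorusSite c) = σ (FermionTorus.toTorusSite c) then (1 : ℂ) else 0 := by
      intro c
      rw [show plaqFamily U σ' c = plaquetteStates U (σ' (FermionTorus.toTorusSite c)).rev from rfl,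
        show plaqFamily U σ c = plaquetteStates U (σ (FermionTorus.toTorusSite c)).rev from rfl,
        star_plaquetteStates_dotProduct]
      by_cases hc : σ' (FermionTorus.toTorusSite c) = σ (FermionTorus.toTorusSite c)
      · rw [if_pos hc, if_pos (by rw [hc])]
      · rw [if_neg hc, if_neg (fun h => hc (Fin.rev_injective h))]
    simp_rw [h1]
    rw [Finset.prod_boole]
    have hiff : (∀ c ∈ @Finset.erase _ inst (@Finset.erase _ inst Finset.univ R) (plaqNbr R k),
        σ' (FermionTorus.toTorusSite c) = σ (FermionTorus.toTorusSite c)) ↔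
        ∀ c : FermionTorus 2 M, c ≠ plaqNbr R k → c ≠ R →
          σ' (FermionTorus.toTorusSite c) = σ (FermionTorus.toTorusSite c) := by
      refine forall_congr' fun c => ?_
      rw [Finset.mem_erase, Finset.mem_erase]
      exact ⟨fun h hN hR => h ⟨hN, hR, Finset.mem_univ c⟩, fun h hm => h hm.1 hm.2.1⟩
    by_cases hc : ∀ c : FermionTorus 2 M, c ≠ plaqNbr R k → c ≠ R →
        σ' (FermionTorus.toTorusSite c) = σ (FermionTorus.toTorusSite c)
    · rw [if_pos hc, if_pos (hiff.2 hc)]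
    · rw [if_neg hc, if_neg (fun h => hc (hiff.1 h))]
  have hloc : ∀ {inst : DecidableEq (FermionTorus 2 M)} (E : FermionTorus 2 M → ℝ),
      (∑ c, E c) - ∑ c ∈ @Finset.erase _ inst (@Finset.erase _ inst Finset.univ R) (plaqNbr R k), E c =
        E R + E (plaqNbr R k) := by
    intro inst E
    have h1 : plaqNbr R k ∈ @Finset.erase _ inst Finset.univ R := Finset.mem_erase.2 ⟨hRN.symm, Finset.mem_univ _⟩
    have h2 := Finset.sum_erase_add (@Finset.erase _ inst Finset.univ R) E h1
    have h3 := Finset.sum_erase_add Finset.univ E (Finset.mem_univ R)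
    rw [← h3, ← h2]
    ring
  rw [hover, hloc] at key
  beta_reduce at key
  -- the local energy is the (common) pair energy
  have hen : plaquetteEnergy U (2 * ((Fin.rev (σ (FermionTorus.toTorusSite R)) : Fin 2) : ℕ)) +
      plaquetteEnergy U (2 * ((Fin.rev (σ (FermionTorus.toTorusSite (plaqNbr R k))) : Fin 2) : ℕ)) =
      (pairEnergy (plaquetteHamiltonian U) (plaquetteStates U)
          ((σ (FermionTorus.toTorusSite R)).rev, (σ (FermionTorus.toTorusSite (plaqNbr R k))).rev) +
        pairEnergy (plaquetteHamiltonian U) (plaquetteStates U)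
          ((σ' (FermionTorus.toTorusSite R)).rev, (σ' (FermionTorus.toTorusSite (plaqNbr R k))).rev)) / 2 := by
    rw [hE, pairEnergy_plaquetteStates]
    ring
  rw [hen] at key
  -- the two-cluster bracket of the hop vectors is `−interClusterKernel`
  obtain ⟨h11, h22, h12, h21⟩ := bond_phases hM R k
  have hop := star_hopVec_dotProduct_reducedResolvent_hopVec_eq_neg_interClusterKernel
    (plaquetteHamiltonian_isHermitian U) B h11 h22 h12 h21 (plaquetteStates U)
    ((σ' (FermionTorus.toTorusSite R)).rev, (σ' (FermionTorus.toTorusSite (plaqNbr R k))).rev)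
    ((σ (FermionTorus.toTorusSite R)).rev, (σ (FermionTorus.toTorusSite (plaqNbr R k))).rev)
  dsimp only at hop
  simp only [plaqFamily] at key ⊢
  rw [hop] at key
  convert key using 4

end Summit.HubbardSuperconductivity.HubbardSuperconductivity.Theorems.LevyLogBootstrap

end
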